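import Literature.NumberTheory.GaloisCohomology.BlochKatoFormsSymbol
import HarnessLib

/-!
# Stub `stub_bkBackwardForms` of crux stmt-ResolutionOfSingularities-17142
# (`WildPurity.PurityTransfer`, line `birth`, lead c1 skeleton rev L4)

The lead's stub: the injectivity half of Bloch–Kato's Lemma (4.2) for a field — an ADDITIVE map
`ψ₀ : Ωⁿ_K = ⋀ⁿ_K Ω[K⁄ℤ] → KatoCohomologySymbolic p K n` with `ψ₀ (a • dlog b₀ ∧ ⋯ ∧ dlog b_{n-1}) = [a, b}`.
The construction lives in the tree: `Literature/NumberTheory/GaloisCohomology/BlochKatoForms.lean`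
(the presentation `K`-module `BlochKatoForms K n` and the `K`-linear `ofForms : ⋀ⁿ Ω[K⁄ℤ] → BlochKatoForms K n`,
slot by slot from the derivation `a ↦ a • e(a, –)`, alternating by polarisation) and
`…/BlochKatoFormsSymbol.lean` (the additive `toSymbolic : BlochKatoForms K n → KatoCohomologySymbolic p K n`);
this file is the registered signature, a one-line consequence of
`BlochKatoForms.exists_addMonoidHom_forms_symbol` (the hypotheses `[Fact p.Prime]`, `[CharP K p]` of the
registered signature are not needed for this direction).
-/

set_option linter.dupNamespace false

noncomputable section

universe u

open Literature.NumberTheory.GaloisCohomology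

namespace Summit.ResolutionOfSingularities.ResolutionOfSingularities.Theorems.WildPurityPurityTransfer

/-- **STUB `stub_bkBackwardForms` (crux `PurityTransfer`, line `birth`)** — the inverse of Bloch–Kato's
`δ` at the level of forms: an additive `ψ₀ : ⋀ⁿ_K Ω[K⁄ℤ] → KatoCohomologySymbolic p K n` with
`ψ₀ (a • dlogForm K b) = [a, b}` (namely `BlochKatoForms.toSymbolic K p ∘ BlochKatoForms.ofForms K n`).
[cite: BlochKato1986, Lemma (4.2), p. 122] -/
theorem stub_bkBackwardForms (p : ℕ) [Fact p.Prime] (K : Type u) [Field K] [CharP K p] (n : ℕ) :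
    ∃ ψ₀ : (⋀[K]^n (Ω[K⁄ℤ])) →+ KatoCohomologySymbolic p K n,
      ∀ (a : K) (b : Fin n → Kˣ), ψ₀ (a • dlogForm K b) = KatoCohomologySymbolic.symbol p a b :=
  BlochKatoForms.exists_addMonoidHom_forms_symbol K p

end Summit.ResolutionOfSingularities.ResolutionOfSingularities.Theorems.WildPurityPurityTransfer

end
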